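import Summits.Ventures.HodgeRepro2.T5RecordJointToyInertPlaces
import Summits.Ventures.HodgeRepro2.T5CyclotomicSevenDegreeOnePrime
import Summits.Ventures.HodgeRepro2.T5CyclotomicSevenHeckeCommutative

/-!
# Joint consistency on the field of record at every DEGREE-ONE inert place

Tier-5 support N3 / §G-N4.2 (seat p3, gen 87). File 358 reads the general joint statement (file 356) at every inert
place of ORDER `6` of `ℚ(ζ₇)` (the constructed places `vPrime K p h6`). The inert places of order `2` (`p ≡ 6 (mod 7)`:
`13, 41, 83, …`; `N(v) = p`) are given existentially by the record (`T5CyclotomicSevenDegreeOnePrime`: for EVERY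
place `v` of `ℚ(ζ₇)⁺` above such a `p` there is `w ∣ v` with `v 𝓞_K = w`), so the joint statement at them is an
existential over `w` (the shape of file 351):

* `natCast_mem_of_liesOver_int` — `p ∈ v` for `v` lying over `(p) ⊂ ℤ`; `seven_notMem_of_liesOver_int` — `7 ∉ v`;
* **`joint_seven_degree_one`** — for every prime `p` with `orderOf (p : ZMod 7) = 2` and every place `v` of `ℚ(ζ₇)⁺`
  above `(p)`: `∃ w, ∃ hmap : v 𝓞_K = w`, the lattice-model data for `diag(1, 1, −1)` at `v` over `vRat p` AND the
  unramified spectrum of the record's pair at `v` with the Satake parameter `α · p⁻²`;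
* **`joint_seven_thirteen`** — the numeral `p = 13`.

With files 349 / 352 / 356 / 358: README §10.5 (ii)(d) holds at EVERY inert place of the field of record (orders
`6` and `2`) and of `ℚ(i)`. The `LiesOver` instances (`v ∣ vRat p`, `w ∣ v`) are bound by `letI := <explicit term>`
in the statement and passed explicitly in the proof (annex §98(d)). §8(d): uses an L-value-free non-vanishing
device: NO.
-/

open Matrix NumberField NumberField.IsCMField IsDedekindDomain IsDedekindDomain.HeightOneSpectrum Module
  MulAction
open scoped TensorProduct Pointwise
open Summit.Ventures.HodgeRepro2.T5UnitaryGroupForm Summit.Ventures.HodgeRepro2.T5UnitaryHeckeAdjoint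
  Summit.Ventures.HodgeRepro2.T5HeckePermutationModule Summit.Ventures.HodgeRepro2.LevelPositivity
  Summit.Ventures.HodgeRepro2.T5LevelIdempotent Summit.Ventures.HodgeRepro2.T5StarOfInvolution
  Summit.Ventures.HodgeRepro2.T5FinitePlaceCM Summit.Ventures.HodgeRepro2.T5NonSplitPlaceUnitaryGroup
  Summit.Ventures.HodgeRepro2.T5RecordHyperspecial Summit.Ventures.HodgeRepro2.T5GlobalLatticeAlmostAll
  Summit.Ventures.HodgeRepro2.T5HermitianThreeElements Summit.Ventures.HodgeRepro2.T5GaloisCartanThree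
  Summit.Ventures.HodgeRepro2.T5InertDegreeGalois Summit.Ventures.HodgeRepro2.T5InertPlaceCompletion
  Summit.Ventures.HodgeRepro2.T5InertDegreeAdicCompletion Summit.Ventures.HodgeRepro2.T5InertSatakeTransform
  Summit.Ventures.HodgeRepro2.T5InertSatakeTransformCompletion Summit.Ventures.HodgeRepro2.T5InertUnipotentResidue
  Summit.Ventures.HodgeRepro2.T5InertSphericalSubquotient Summit.Ventures.HodgeRepro2.T5RecordSatakeCell
  Summit.Ventures.HodgeRepro2.T5SplitPlaceUnitaryGroup Summit.Ventures.HodgeRepro2.T5FinitePlaceNormIndex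
  Summit.Ventures.HodgeRepro2.T5HermitianLocalIsotropyN3 Summit.Ventures.HodgeRepro2.T5FinitePlaceSplitClassification
  Summit.Ventures.HodgeRepro2.T5InertDegreeCompletion Summit.Ventures.HodgeRepro2.T5InertPlaceCompletionCells
  Summit.Ventures.HodgeRepro2.T5RecordSatake Summit.Ventures.HodgeRepro2.T5CartanCellsDistinct
  Summit.Ventures.HodgeRepro2.T5RecordSatakeInert Summit.Ventures.HodgeRepro2.T5InertGlobalPrime
  Summit.Ventures.HodgeRepro2.T5CMFieldSquareDatum Summit.Ventures.HodgeRepro2.T5RecordSatakeDegree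
  Summit.Ventures.HodgeRepro2.T5RecordSatakeDegreeIntrinsic Summit.Ventures.HodgeRepro2.T5RecordSphericalSpectrum
  Summit.Ventures.HodgeRepro2.T5RecordSphericalSpectrumIntrinsic Summit.Ventures.HodgeRepro2.T5RecordSatakeToy
  Summit.Ventures.HodgeRepro2.T5RecordSphericalSpectrumDatumFree
  Summit.Ventures.HodgeRepro2.T5AdditiveConductor Summit.Ventures.HodgeRepro2.T5UnitaryGroupIsometry
  Summit.Ventures.HodgeRepro2.T5ConductorDualLattice Summit.Ventures.HodgeRepro2.T5ConductorDualLatticeSplit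
  Summit.Ventures.HodgeRepro2.T5SplitHermitianClass Summit.Ventures.HodgeRepro2.T5RecordLatticeModelOutsideDiscriminant
  Summit.Ventures.HodgeRepro2.T5RecordLatticeModelSeven Summit.Ventures.HodgeRepro2.T5RecordJointOutsideDiscriminant
  Summit.Ventures.HodgeRepro2.T5RationalPlace Summit.Ventures.HodgeRepro2.T5ConductorZeroCharacter
  Summit.Ventures.HodgeRepro2.T5CyclotomicSevenDegreeOnePrime Summit.Ventures.HodgeRepro2.T5CyclotomicSevenHeckeCommutative

namespace Summit.Ventures.HodgeRepro2.T5RecordJointSevenDegreeOne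

universe uV

section Generic

variable (K : Type*) [Field K] [CharZero K] [IsCyclotomicExtension {7} ℚ K] [NumberField K] [IsCMField K]
variable (p : ℕ) [hp : Fact p.Prime] (h2 : orderOf (p : ZMod 7) = 2)
variable (v : HeightOneSpectrum (𝓞 (maximalRealSubfield K))) [hv : v.asIdeal.LiesOver (Ideal.span {(p : ℤ)})]
variable (k : Type*) [Field k] [CharZero k] [IsAlgClosed k]

omit [CharZero K] [IsCyclotomicExtension {7} ℚ K] [NumberField K] [IsCMField K] hp in
/-- `p ∈ v` for a place `v` of `K⁺` lying over `(p) ⊂ ℤ`. -/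
theorem natCast_mem_of_liesOver_int : (p : 𝓞 (maximalRealSubfield K)) ∈ v.asIdeal := by
  have h : (p : ℤ) ∈ v.asIdeal.under ℤ := by
    rw [← hv.over]
    exact Ideal.mem_span_singleton_self _
  rw [Ideal.mem_under] at h
  simpa using h

omit [CharZero K] [IsCyclotomicExtension {7} ℚ K] [NumberField K] [IsCMField K] in
include h2 in
/-- `7 ∉ v` for `v` above a prime `p` of order `2` modulo `7` (`p ∤ 7`). -/
theorem seven_notMem_of_liesOver_int : (7 : 𝓞 (maximalRealSubfield K)) ∉ v.asIdeal := by
  have h := notMem_of_mem_of_prime_of_not_dvd v.asIdeal v.isPrime.ne_top hp.out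
    (not_dvd_seven_of_orderOf_eq_two p h2) (natCast_mem_of_liesOver_int K p v)
  exact_mod_cast h

include h2 in
/-- **JOINT CONSISTENCY ON `ℚ(ζ₇)` AT EVERY DEGREE-ONE INERT PLACE** (file 356 at `vp = vRat p` and the place `w ∣ v`
with `v 𝓞_K = w` supplied by `exists_liesOver_and_map_eq`): for every prime `p ≡ 6 (mod 7)` and every place `v` of
`ℚ(ζ₇)⁺` above it, the lattice-model data for `diag(1, 1, −1)` AND the unramified spectrum of the record's pair with
the Satake parameter `α · N(v)⁻² = α · p⁻²`. -/
theorem joint_seven_degree_one :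
    letI : v.asIdeal.LiesOver (vRat p).asIdeal := liesOver_vRat_of_mem p v (natCast_mem_of_liesOver_int K p v)
    ∃ (w : HeightOneSpectrum (𝓞 K))
      (hmap : Ideal.map (algebraMap (𝓞 (maximalRealSubfield K)) (𝓞 K)) v.asIdeal = w.asIdeal),
      letI := liesOver_of_map_eq K v w hmap
      ((∃ ψ : AddChar ((vRat p).adicCompletion ℚ) Circle, Continuous ψ ∧ (∃ y, ψ y ≠ 1) ∧
        conductorExp ψ (Valued.v : Valuation ((vRat p).adicCompletion ℚ) (WithZero (Multiplicative ℤ))) = 0 ∧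
        conductorExp (ψ.compAddMonoidHom
          (Algebra.trace ((vRat p).adicCompletion ℚ) (v.adicCompletion (maximalRealSubfield K))).toAddMonoidHom)
          (Valued.v : Valuation (v.adicCompletion (maximalRealSubfield K)) (WithZero (Multiplicative ℤ))) = 0) ∧
      ∀ (ψ : AddChar ((vRat p).adicCompletion ℚ) Circle), Continuous ψ → (∃ y, ψ y ≠ 1) →
        conductorExp ψ (Valued.v : Valuation ((vRat p).adicCompletion ℚ) (WithZero (Multiplicative ℤ))) = 0 →
        ∀ (w' : HeightOneSpectrum (𝓞 K)) [w'.asIdeal.LiesOver v.asIdeal],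
          v.asIdeal.ramificationIdx' w'.asIdeal = 1 ∧
          conductorExp (recordChar K (vRat p) v w' ψ)
            (Valued.v : Valuation (w'.adicCompletion K) (WithZero (Multiplicative ℤ))) = 0 ∧
          (∀ x : w'.adicCompletion K,
            (∀ y : w'.adicCompletion K, Valued.v y ≤ 1 → recordChar K (vRat p) v w' ψ (x * y) = 1) ↔ Valued.v x ≤ 1) ∧
          (∀ [StarRing (w'.adicCompletion K)],
            (∀ z : w'.adicCompletion K, IsLocalization.IsInteger (w'.adicCompletionIntegers K) z →
              IsLocalization.IsInteger (w'.adicCompletionIntegers K) (star z)) →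
            ∀ x : Fin 3 → w'.adicCompletion K,
              (∀ y ∈ stdLattice (w'.adicCompletionIntegers K),
                recordChar K (vRat p) v w' ψ
                  (sesqForm (((algebraMap (𝓞 K) K).mapMatrix (Matrix.diagonal ![1, 1, -1])).map (algebraMap K (w'.adicCompletion K))) x y) = 1) ↔
                x ∈ stdLattice (w'.adicCompletionIntegers K)) ∧
          (letI := swapStarRing (w'.adicCompletion K)
            ∀ x : Fin 3 → w'.adicCompletion K × w'.adicCompletion K,
              (∀ y : Fin 3 → w'.adicCompletion K × w'.adicCompletion K,
                (∀ i, Valued.v (y i).1 ≤ 1 ∧ Valued.v (y i).2 ≤ 1) →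
                recordChar K (vRat p) v w' ψ
                    (sesqForm (pairMatrix (((algebraMap (𝓞 K) K).mapMatrix (Matrix.diagonal ![1, 1, -1])).map (algebraMap K (w'.adicCompletion K)))
                      (((algebraMap (𝓞 K) K).mapMatrix (Matrix.diagonal ![1, 1, -1])).map (algebraMap K (w'.adicCompletion K)))ᵀ) x y).1 *
                  recordChar K (vRat p) v w' ψ
                    (sesqForm (pairMatrix (((algebraMap (𝓞 K) K).mapMatrix (Matrix.diagonal ![1, 1, -1])).map (algebraMap K (w'.adicCompletion K)))
                      (((algebraMap (𝓞 K) K).mapMatrix (Matrix.diagonal ![1, 1, -1])).map (algebraMap K (w'.adicCompletion K)))ᵀ) x y).2 = 1) ↔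
                ∀ i, Valued.v (x i).1 ≤ 1 ∧ Valued.v (x i).2 ≤ 1)) ∧
      (∃ (θ : maximalRealSubfield K) (y : K) (hθ : algebraMap (maximalRealSubfield K) K θ = y ^ 2)
        (hy : complexConj K y ≠ y) (r : ℕ) (l : Fin r → 𝓞 K)
        (_hl : Submodule.span (𝓞 (maximalRealSubfield K)) (Set.range l) = ⊤),
        letI := tensorStarRing K v
        letI := starRingOfQuadratic (finrank_eq_two K v w hθ hy (not_isSquare_of_staysPrime K v w hθ hy hmap))
          (localConj v w hθ.symm (span_pair_eq_top K hy) (not_isSquare_of_staysPrime K v w hθ hy hmap) (complexConj K))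
          (localConj_ne_one v w hθ.symm (span_pair_eq_top K hy) (not_isSquare_of_staysPrime K v w hθ hy hmap)
            (complexConj K) (complexConj_apply_eq_neg K hθ hy))
        haveI := isDiscreteValuationRing_integralClosure_adicCompletion v w
        haveI := finite_residueField_integralClosure_adicCompletion v w
        haveI : IsFractionRing (integralClosure (v.adicCompletionIntegers (maximalRealSubfield K)) (w.adicCompletion K))
          (w.adicCompletion K) :=
          integralClosure.isFractionRing_of_finite_extension (v.adicCompletion (maximalRealSubfield K))
            (w.adicCompletion K)
        ∃ (u₀ : (v.adicCompletionIntegers (maximalRealSubfield K))ˣ)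
          (Φ : ↥(formUnitaryGroup (J3 (algebraMap (v.adicCompletionIntegers (maximalRealSubfield K))
            (w.adicCompletion K) (u₀ : v.adicCompletionIntegers (maximalRealSubfield K))))) ≃*
            ↥(formUnitaryGroup (tensorGram K v (gramToy K))))
          (ϖ' : integralClosure (v.adicCompletionIntegers (maximalRealSubfield K)) (w.adicCompletion K))
          (hϖ' : Irreducible ϖ')
          (hs' : star (algebraMap (integralClosure (v.adicCompletionIntegers (maximalRealSubfield K))
            (w.adicCompletion K)) (w.adicCompletion K) ϖ') =
              algebraMap (integralClosure (v.adicCompletionIntegers (maximalRealSubfield K)) (w.adicCompletion K))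
                (w.adicCompletion K) ϖ'),
          (∀ g, g ∈ hyperspecialSubgroup
              (integralClosure (v.adicCompletionIntegers (maximalRealSubfield K)) (w.adicCompletion K))
              (J3 (algebraMap (v.adicCompletionIntegers (maximalRealSubfield K)) (w.adicCompletion K)
                (u₀ : v.adicCompletionIntegers (maximalRealSubfield K)))) ↔ Φ g ∈ recordHyperspecial K v l (gramToy K)) ∧
          ∀ {V : Type uV} [AddCommGroup V] [Module k V]
            (ρ : Representation k (↥(formUnitaryGroup (tensorGram K v (gramToy K)))) V) [ρ.IsIrreducible],
            KFinite ρ (recordHyperspecial K v l (gramToy K)) →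
            ∀ [FiniteDimensional k (invariants ρ (recordHyperspecial K v l (gramToy K)))],
            invariants ρ (recordHyperspecial K v l (gramToy K)) ≠ ⊥ →
            ∃ α : k, α ≠ 0 ∧ Nonempty (ρ.Equiv (comp Φ.symm
              (inertSphericalQuot
                (hstar_of_star_eq (localConj v w hθ.symm (span_pair_eq_top K hy)
                  (not_isSquare_of_staysPrime K v w hθ hy hmap) (complexConj K))
                  (fun x => by rw [star_p8_eq_star K v w hθ hy (not_isSquare_of_staysPrime K v w hθ hy hmap)]; rfl))
                (algebraMap (v.adicCompletionIntegers (maximalRealSubfield K)) (w.adicCompletion K)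
                  (u₀ : v.adicCompletionIntegers (maximalRealSubfield K)))
                (star_algebraMap_of_star_eq (localConj v w hθ.symm (span_pair_eq_top K hy)
                  (not_isSquare_of_staysPrime K v w hθ hy hmap) (complexConj K))
                  (fun x => by rw [star_p8_eq_star K v w hθ hy (not_isSquare_of_staysPrime K v w hθ hy hmap)]; rfl)
                  (u₀ : v.adicCompletionIntegers (maximalRealSubfield K)))
                (algebraMap_unit_ne_zero (F := v.adicCompletion (maximalRealSubfield K)) u₀)
                (isInteger_algebraMap (u₀ : v.adicCompletionIntegers (maximalRealSubfield K)))
                (isInteger_algebraMap_unit_inv u₀) hϖ' hs' k (α * ((Ideal.absNorm v.asIdeal : k) ^ 2)⁻¹))))) :=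
  (exists_liesOver_and_map_eq K p h2 v).elim fun w hwm =>
    ⟨w, hwm.2, @joint_outside_discriminant_of_staysPrime K _ _ _ (vRat p) v
      (liesOver_vRat_of_mem p v (natCast_mem_of_liesOver_int K p v))
      (discr_seven_notMem K v (seven_notMem_of_liesOver_int K p h2 v)) w (liesOver_of_map_eq K v w hwm.2) hwm.2
      k _ _ _⟩

end Generic

section Thirteen

variable (K : Type*) [Field K] [CharZero K] [IsCyclotomicExtension {7} ℚ K] [NumberField K] [IsCMField K]
variable [Fact (Nat.Prime 13)]
variable (v : HeightOneSpectrum (𝓞 (maximalRealSubfield K))) [hv : v.asIdeal.LiesOver (Ideal.span {(13 : ℤ)})]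
variable (k : Type*) [Field k] [CharZero k] [IsAlgClosed k]

/-- **JOINT CONSISTENCY ON `ℚ(ζ₇)` AT EVERY PLACE ABOVE `13`** (`N(v) = 13`, Satake parameter `α · 13⁻²`). -/
theorem joint_seven_thirteen :
    letI : v.asIdeal.LiesOver (vRat 13).asIdeal := liesOver_vRat_of_mem 13 v (natCast_mem_of_liesOver_int K 13 v)
    ∃ (w : HeightOneSpectrum (𝓞 K))
      (hmap : Ideal.map (algebraMap (𝓞 (maximalRealSubfield K)) (𝓞 K)) v.asIdeal = w.asIdeal),
      letI := liesOver_of_map_eq K v w hmap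
      ((∃ ψ : AddChar ((vRat 13).adicCompletion ℚ) Circle, Continuous ψ ∧ (∃ y, ψ y ≠ 1) ∧
        conductorExp ψ (Valued.v : Valuation ((vRat 13).adicCompletion ℚ) (WithZero (Multiplicative ℤ))) = 0 ∧
        conductorExp (ψ.compAddMonoidHom
          (Algebra.trace ((vRat 13).adicCompletion ℚ) (v.adicCompletion (maximalRealSubfield K))).toAddMonoidHom)
          (Valued.v : Valuation (v.adicCompletion (maximalRealSubfield K)) (WithZero (Multiplicative ℤ))) = 0) ∧
      ∀ (ψ : AddChar ((vRat 13).adicCompletion ℚ) Circle), Continuous ψ → (∃ y, ψ y ≠ 1) →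
        conductorExp ψ (Valued.v : Valuation ((vRat 13).adicCompletion ℚ) (WithZero (Multiplicative ℤ))) = 0 →
        ∀ (w' : HeightOneSpectrum (𝓞 K)) [w'.asIdeal.LiesOver v.asIdeal],
          v.asIdeal.ramificationIdx' w'.asIdeal = 1 ∧
          conductorExp (recordChar K (vRat 13) v w' ψ)
            (Valued.v : Valuation (w'.adicCompletion K) (WithZero (Multiplicative ℤ))) = 0 ∧
          (∀ x : w'.adicCompletion K,
            (∀ y : w'.adicCompletion K, Valued.v y ≤ 1 → recordChar K (vRat 13) v w' ψ (x * y) = 1) ↔ Valued.v x ≤ 1) ∧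
          (∀ [StarRing (w'.adicCompletion K)],
            (∀ z : w'.adicCompletion K, IsLocalization.IsInteger (w'.adicCompletionIntegers K) z →
              IsLocalization.IsInteger (w'.adicCompletionIntegers K) (star z)) →
            ∀ x : Fin 3 → w'.adicCompletion K,
              (∀ y ∈ stdLattice (w'.adicCompletionIntegers K),
                recordChar K (vRat 13) v w' ψ
                  (sesqForm (((algebraMap (𝓞 K) K).mapMatrix (Matrix.diagonal ![1, 1, -1])).map (algebraMap K (w'.adicCompletion K))) x y) = 1) ↔
                x ∈ stdLattice (w'.adicCompletionIntegers K)) ∧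
          (letI := swapStarRing (w'.adicCompletion K)
            ∀ x : Fin 3 → w'.adicCompletion K × w'.adicCompletion K,
              (∀ y : Fin 3 → w'.adicCompletion K × w'.adicCompletion K,
                (∀ i, Valued.v (y i).1 ≤ 1 ∧ Valued.v (y i).2 ≤ 1) →
                recordChar K (vRat 13) v w' ψ
                    (sesqForm (pairMatrix (((algebraMap (𝓞 K) K).mapMatrix (Matrix.diagonal ![1, 1, -1])).map (algebraMap K (w'.adicCompletion K)))
                      (((algebraMap (𝓞 K) K).mapMatrix (Matrix.diagonal ![1, 1, -1])).map (algebraMap K (w'.adicCompletion K)))ᵀ) x y).1 *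
                  recordChar K (vRat 13) v w' ψ
                    (sesqForm (pairMatrix (((algebraMap (𝓞 K) K).mapMatrix (Matrix.diagonal ![1, 1, -1])).map (algebraMap K (w'.adicCompletion K)))
                      (((algebraMap (𝓞 K) K).mapMatrix (Matrix.diagonal ![1, 1, -1])).map (algebraMap K (w'.adicCompletion K)))ᵀ) x y).2 = 1) ↔
                ∀ i, Valued.v (x i).1 ≤ 1 ∧ Valued.v (x i).2 ≤ 1)) ∧
      (∃ (θ : maximalRealSubfield K) (y : K) (hθ : algebraMap (maximalRealSubfield K) K θ = y ^ 2)
        (hy : complexConj K y ≠ y) (r : ℕ) (l : Fin r → 𝓞 K)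
        (_hl : Submodule.span (𝓞 (maximalRealSubfield K)) (Set.range l) = ⊤),
        letI := tensorStarRing K v
        letI := starRingOfQuadratic (finrank_eq_two K v w hθ hy (not_isSquare_of_staysPrime K v w hθ hy hmap))
          (localConj v w hθ.symm (span_pair_eq_top K hy) (not_isSquare_of_staysPrime K v w hθ hy hmap) (complexConj K))
          (localConj_ne_one v w hθ.symm (span_pair_eq_top K hy) (not_isSquare_of_staysPrime K v w hθ hy hmap)
            (complexConj K) (complexConj_apply_eq_neg K hθ hy))
        haveI := isDiscreteValuationRing_integralClosure_adicCompletion v w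
        haveI := finite_residueField_integralClosure_adicCompletion v w
        haveI : IsFractionRing (integralClosure (v.adicCompletionIntegers (maximalRealSubfield K)) (w.adicCompletion K))
          (w.adicCompletion K) :=
          integralClosure.isFractionRing_of_finite_extension (v.adicCompletion (maximalRealSubfield K))
            (w.adicCompletion K)
        ∃ (u₀ : (v.adicCompletionIntegers (maximalRealSubfield K))ˣ)
          (Φ : ↥(formUnitaryGroup (J3 (algebraMap (v.adicCompletionIntegers (maximalRealSubfield K))
            (w.adicCompletion K) (u₀ : v.adicCompletionIntegers (maximalRealSubfield K))))) ≃*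
            ↥(formUnitaryGroup (tensorGram K v (gramToy K))))
          (ϖ' : integralClosure (v.adicCompletionIntegers (maximalRealSubfield K)) (w.adicCompletion K))
          (hϖ' : Irreducible ϖ')
          (hs' : star (algebraMap (integralClosure (v.adicCompletionIntegers (maximalRealSubfield K))
            (w.adicCompletion K)) (w.adicCompletion K) ϖ') =
              algebraMap (integralClosure (v.adicCompletionIntegers (maximalRealSubfield K)) (w.adicCompletion K))
                (w.adicCompletion K) ϖ'),
          (∀ g, g ∈ hyperspecialSubgroup
              (integralClosure (v.adicCompletionIntegers (maximalRealSubfield K)) (w.adicCompletion K))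
              (J3 (algebraMap (v.adicCompletionIntegers (maximalRealSubfield K)) (w.adicCompletion K)
                (u₀ : v.adicCompletionIntegers (maximalRealSubfield K)))) ↔ Φ g ∈ recordHyperspecial K v l (gramToy K)) ∧
          ∀ {V : Type uV} [AddCommGroup V] [Module k V]
            (ρ : Representation k (↥(formUnitaryGroup (tensorGram K v (gramToy K)))) V) [ρ.IsIrreducible],
            KFinite ρ (recordHyperspecial K v l (gramToy K)) →
            ∀ [FiniteDimensional k (invariants ρ (recordHyperspecial K v l (gramToy K)))],
            invariants ρ (recordHyperspecial K v l (gramToy K)) ≠ ⊥ →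
            ∃ α : k, α ≠ 0 ∧ Nonempty (ρ.Equiv (comp Φ.symm
              (inertSphericalQuot
                (hstar_of_star_eq (localConj v w hθ.symm (span_pair_eq_top K hy)
                  (not_isSquare_of_staysPrime K v w hθ hy hmap) (complexConj K))
                  (fun x => by rw [star_p8_eq_star K v w hθ hy (not_isSquare_of_staysPrime K v w hθ hy hmap)]; rfl))
                (algebraMap (v.adicCompletionIntegers (maximalRealSubfield K)) (w.adicCompletion K)
                  (u₀ : v.adicCompletionIntegers (maximalRealSubfield K)))
                (star_algebraMap_of_star_eq (localConj v w hθ.symm (span_pair_eq_top K hy)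
                  (not_isSquare_of_staysPrime K v w hθ hy hmap) (complexConj K))
                  (fun x => by rw [star_p8_eq_star K v w hθ hy (not_isSquare_of_staysPrime K v w hθ hy hmap)]; rfl)
                  (u₀ : v.adicCompletionIntegers (maximalRealSubfield K)))
                (algebraMap_unit_ne_zero (F := v.adicCompletion (maximalRealSubfield K)) u₀)
                (isInteger_algebraMap (u₀ : v.adicCompletionIntegers (maximalRealSubfield K)))
                (isInteger_algebraMap_unit_inv u₀) hϖ' hs' k (α * ((Ideal.absNorm v.asIdeal : k) ^ 2)⁻¹))))) :=
  joint_seven_degree_one K 13 orderOf_natCast_thirteen_zmod_seven v k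

end Thirteen

end Summit.Ventures.HodgeRepro2.T5RecordJointSevenDegreeOne
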